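import Summits.CriticalPhenomena.SAWScalingLimit.Theorems.SAWRestrictionRigidityLimitExists
import Summits.CriticalPhenomena.SAWScalingLimit.Theorems.SAWRestrictionRigidityLimitExistsTightNecessity
import HarnessLib

/-!
# Crux `LimitExists` (stmt-CriticalPhenomena-1371), line `registered` — the crux IS tightness plus uniqueness

The exact content of the crux, isolated from the particular uniqueness engine of the line: the critical `δℤ²`
SAW laws have a full scaling limit as a chordal curve family IF AND ONLY IF they are eventually tight (the
stub (T) = item stmt-CriticalPhenomena-1372) AND, for every Dobrushin domain, all probability subsequential
limits — along every endpoint approximation and every mesh sequence — coincide.  The registered line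
proves the uniqueness half from (S) + (C) through `AvoidanceDeterminesLaw_holds`; this file records that
nothing else is being proved and nothing less would do.

* `limitExists_iff_eventualTight_and_uniqueSubseqLimits` — Billingsley's subsequence principle along the
  countably generated filter `𝓝[>] 0` (`exists_subseqLimit`, Prokhorov past the junk meshes;
  `tendsto_of_subseq_tendsto`), chordality of subsequential limits from the tree lemmas
  `ae_endpoints_of_hyps` / `ae_range_subset_closure_of_hyps`, and, for the forward direction,
  `eventualTight_of_limitExists` (p148374) with the identification of every subsequential limit with the
  full limit (bounded continuous integrals determine finite Borel measures).

Everything proved, standard axioms. [cite: BillingsleyCPM1999, Thm. 2.6]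
-/

noncomputable section

open MeasureTheory Filter Topology Set Metric Function
open Literature.Probability.RandomPlanarGeometry Literature.Probability.RandomPlanarGeometry.SAW
open Literature.Probability.LatticeModels
open scoped ENNReal NNReal BoundedContinuousFunction MeasureTheory Topology ProbabilityTheory

namespace Summit.CriticalPhenomena.SAWScalingLimit.Theorems.SAWRestrictionRigidityLimitExists

open Summit.CriticalPhenomena.SAWScalingLimit.Theses.SAWRestrictionRigidity (LimitExists EventualTight)
open Summit.CriticalPhenomena.SAWScalingLimit.Theorems.SubseqIdentification.Negative
  (ae_endpoints_of_hyps ae_range_subset_closure_of_hyps)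

/-- **Tightness + uniqueness of subsequential limits ⇒ a full scaling-limit family.**  If the pushed
critical SAW laws are eventually tight and, in every Dobrushin domain, all probability subsequential
limits along all endpoint approximations and mesh sequences coincide, then some chordal family `P` is
the full limit: per domain pick an endpoint approximation (`SAW.exists_isEndpointApprox`), the meshes
`1/(n+1)` and a probability subsequential limit `P D` (`exists_subseqLimit`); it is chordal (tree lemmas),
and `tendsto_of_subseq_tendsto` along the countably generated `𝓝[>] 0` gives `TendstoLaw`.
[cite: BillingsleyCPM1999, Thm. 2.6] -/
theorem exists_isScalingLimitFamily_of_tight_of_unique (hT : EventualTight)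
    (hU : ∀ (D : DobrushinDomain) (a b a' b' : ℝ → Site 2), SAW.IsEndpointApprox D a b →
      SAW.IsEndpointApprox D a' b' → ∀ (s s' : ℕ → ℝ) (ν ν' : Measure (CurveClass ℂ)),
      Tendsto s atTop (𝓝[>] (0 : ℝ)) → Tendsto s' atTop (𝓝[>] (0 : ℝ)) →
      IsProbabilityMeasure ν → IsProbabilityMeasure ν' →
      (∀ f : CurveClass ℂ →ᵇ ℝ, Tendsto (fun n => ∫ γ, f γ.curve
        ∂(SAW.law D.carrier (s n) (a (s n)) (b (s n)))) atTop (𝓝 (∫ x, f x ∂ν))) →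
      (∀ f : CurveClass ℂ →ᵇ ℝ, Tendsto (fun n => ∫ γ, f γ.curve
        ∂(SAW.law D.carrier (s' n) (a' (s' n)) (b' (s' n)))) atTop (𝓝 (∫ x, f x ∂ν'))) → ν = ν') :
    ∃ P : ChordalFamily, SAW.IsScalingLimitFamily P := by
  classical
  -- adapted from `exists_isScalingLimitFamily_of_items` (p145872), with the uniqueness hypothesis abstracted
  have hs₁ : Tendsto (fun n : ℕ => 1 / ((n : ℝ) + 1)) atTop (𝓝[>] (0 : ℝ)) :=
    tendsto_nhdsWithin_iff.2 ⟨tendsto_one_div_add_atTop_nhds_zero_nat,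
      Filter.Eventually.of_forall fun n => Set.mem_Ioi.2 Nat.one_div_pos_of_nat⟩
  have key : ∀ D : DobrushinDomain, ∃ (a b : ℝ → Site 2) (s : ℕ → ℝ) (ν : Measure (CurveClass ℂ)),
      SAW.IsEndpointApprox D a b ∧ Tendsto s atTop (𝓝[>] (0 : ℝ)) ∧ IsProbabilityMeasure ν ∧
      ∀ f : CurveClass ℂ →ᵇ ℝ, Tendsto (fun n => ∫ γ, f γ.curve
        ∂(SAW.law D.carrier (s n) (a (s n)) (b (s n)))) atTop (𝓝 (∫ x, f x ∂ν)) := by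
    intro D
    obtain ⟨a, b, hab⟩ := SAW.exists_isEndpointApprox D
    obtain ⟨δ₀, hδ₀, htight⟩ := hT D a b hab
    obtain ⟨φ, ν, hφ, hν, hlim⟩ := exists_subseqLimit hab hδ₀ htight hs₁
    exact ⟨a, b, fun n => 1 / (((φ n : ℕ) : ℝ) + 1), ν, hab, hs₁.comp hφ.tendsto_atTop, hν, hlim⟩
  choose a₀ b₀ s₀ P hab₀ hs₀ hP hlim₀ using key
  refine ⟨P, fun D => ⟨hP D, ?_⟩, fun D a b hab f => ?_⟩
  · haveI := hP D
    filter_upwards [ae_endpoints_of_hyps (hab₀ D) (hs₀ D) (hlim₀ D),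
      ae_range_subset_closure_of_hyps (hab₀ D) (hs₀ D) (hlim₀ D)] with γ h1 h2
    exact ⟨h1.1, h1.2, h2⟩
  · refine tendsto_of_subseq_tendsto fun ns hns => ?_
    obtain ⟨δ₀, hδ₀, htight⟩ := hT D a b hab
    obtain ⟨φ, ν, hφ, hν, hlim⟩ := exists_subseqLimit hab hδ₀ htight hns
    have hν' : ν = P D :=
      hU D a b (a₀ D) (b₀ D) hab (hab₀ D) (fun n => ns (φ n)) (s₀ D) ν (P D)
        (hns.comp hφ.tendsto_atTop) (hs₀ D) hν (hP D) hlim (hlim₀ D)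
    refine ⟨φ, ?_⟩
    have h := hlim f
    rw [hν'] at h
    simpa only [id_eq] using h

/-- **`LimitExists ↔ EventualTight ∧ (uniqueness of subsequential limits)`** — the crux of the line is
EXACTLY its tightness stub (T) (item stmt-CriticalPhenomena-1372) together with the coincidence, in every
Dobrushin domain, of all probability subsequential limits across endpoint approximations and mesh
sequences; the registered stubs (S), (C) enter only as one sufficient condition for the latter
(`avoidanceAgreement_of_items` + `AvoidanceDeterminesLaw_holds`).  Forward: `eventualTight_of_limitExists`
and "a subsequential limit is the full limit"; backward: `exists_isScalingLimitFamily_of_tight_of_unique`.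
[cite: BillingsleyCPM1999, Thm. 2.6] -/
theorem limitExists_iff_eventualTight_and_uniqueSubseqLimits : Summit.CriticalPhenomena.SAWScalingLimit.Theses.SAWRestrictionRigidity.LimitExists ↔ (Summit.CriticalPhenomena.SAWScalingLimit.Theses.SAWRestrictionRigidity.EventualTight ∧ ∀ (D : Literature.Probability.RandomPlanarGeometry.DobrushinDomain) (a b a' b' : ℝ → Literature.Probability.LatticeModels.Site 2), Literature.Probability.RandomPlanarGeometry.SAW.IsEndpointApprox D a b → Literature.Probability.RandomPlanarGeometry.SAW.IsEndpointApprox D a' b' → ∀ (s s' : ℕ → ℝ) (ν ν' : MeasureTheory.Measure (Literature.Probability.RandomPlanarGeometry.CurveClass ℂ)), Filter.Tendsto s Filter.atTop (nhdsWithin 0 (Set.Ioi 0)) → Filter.Tendsto s' Filter.atTop (nhdsWithin 0 (Set.Ioi 0)) → MeasureTheory.IsProbabilityMeasure ν → MeasureTheory.IsProbabilityMeasure ν' → (∀ f : BoundedContinuousFunction (Literature.Probability.RandomPlanarGeometry.CurveClass ℂ) ℝ, Filter.Tendsto (fun n => ∫ γ, f γ.curve ∂(Literature.Probability.RandomPlanarGeometry.SAW.law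 D.carrier (s n) (a (s n)) (b (s n)))) Filter.atTop (nhds (∫ x, f x ∂ν))) → (∀ f : BoundedContinuousFunction (Literature.Probability.RandomPlanarGeometry.CurveClass ℂ) ℝ, Filter.Tendsto (fun n => ∫ γ, f γ.curve ∂(Literature.Probability.RandomPlanarGeometry.SAW.law D.carrier (s' n) (a' (s' n)) (b' (s' n)))) Filter.atTop (nhds (∫ x, f x ∂ν'))) → ν = ν') := by
  constructor
  · intro h
    refine ⟨eventualTight_of_limitExists h, ?_⟩
    obtain ⟨P, hPch, hPlim⟩ := h
    intro D a b a' b' hab hab' s s' ν ν' hs hs' hν hν' hw hw'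
    -- both subsequential limits are the full limit `P D`
    have key : ∀ {a b : ℝ → Site 2} {s : ℕ → ℝ} {ν : Measure (CurveClass ℂ)},
        SAW.IsEndpointApprox D a b → Tendsto s atTop (𝓝[>] (0 : ℝ)) → IsProbabilityMeasure ν →
        (∀ f : CurveClass ℂ →ᵇ ℝ, Tendsto (fun n => ∫ γ, f γ.curve
          ∂(SAW.law D.carrier (s n) (a (s n)) (b (s n)))) atTop (𝓝 (∫ x, f x ∂ν))) → ν = P D := by
      intro a b s ν hab hs hν hw
      haveI := (hPch D).1
      haveI := hν
      refine ext_of_forall_integral_eq_of_IsFiniteMeasure fun f => ?_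
      have h2 : Tendsto (fun n => ∫ γ, f γ.curve ∂(SAW.law D.carrier (s n) (a (s n)) (b (s n))))
          atTop (𝓝 (∫ x, f x ∂(P D))) := by
        simpa only [id_eq, Function.comp_def] using (hPlim D a b hab f).comp hs
      exact tendsto_nhds_unique (hw f) h2
    rw [key hab hs hν hw, key hab' hs' hν' hw']
  · rintro ⟨hT, hU⟩
    exact exists_isScalingLimitFamily_of_tight_of_unique hT hU

end Summit.CriticalPhenomena.SAWScalingLimit.Theorems.SAWRestrictionRigidityLimitExists

end
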